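import Mathlib
import HarnessLib
import Literature.Analysis.FluidPDE.SelfSimilar
import Literature.Analysis.FluidPDE.TaoEnstrophyLocalisation
import Literature.Analysis.UnboundedOperators.HeatKernelGradient
import Summits.NavierStokesRegularity.NavierStokesRegularity.Theorems.HalfSpaceWindowDoorCirculationCarryingRigidityPlaneFluxHeightWindow
import Summits.NavierStokesRegularity.NavierStokesRegularity.Theorems.ChiralWindowDoorClassDerivDecay

/-!
# Route `HalfSpaceWindowDoor`, crux `CirculationCarryingRigidity` (stmt-NavierStokesRegularity-25311) — a field with CUBIC decay
# paired with the gradient of a wide Gaussian window is small (lemma for `…PlaneFluxConservation`)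

For a continuous scalar `Q` on `ℝ³` with `|Q(x)|(‖x‖+ρ)³ ≤ A₃` (`ρ > 0`), every `L, R > 0`, height `c` and `j = 0, 1`:
`|∫ Q(y,c) ∂ⱼg_{L,0}(y) dy| ≤ (A₃/(2ρL²))·(1/R + eR²/(4ρL²))` (`abs_integral_mul_fderiv_gaussWin_le_of_decay`; with
`|∂ⱼg_{L,0}(y)| ≤ g‖y‖/(2L²)`, `‖y‖/(‖x‖+ρ)³ ≤ 1/(ρ(‖y‖+ρ))` and `J(L) = ∫ g/(‖y‖+ρ) ≤ 1/R + eR²/(4ρL²)` from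
`…PlaneFluxHeightWindow.integral_gaussWin_div_le`).  The six flux pairings of the dynamic windowed plane-flux law
(`…PlaneFluxDynamics`) are of this form under space–time Type-I decay.

Seat ns-hsw-p1 g2 (LEAD of 25311, cell pub-ns-dss).  WHAT THIS IS NOT: not a statement about Navier–Stokes regularity;
a calculus lemma; helper `--supports` 25311.
-/

noncomputable section

-- the summit and its single sub-problem share the name (CONVENTIONS §1), as in every Theorems file
set_option linter.dupNamespace false

namespace Summit.NavierStokesRegularity.NavierStokesRegularity.Theorems.HalfSpaceWindowDoorCirculationCarryingRigidityPlaneFluxDecayPairing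

open MeasureTheory Set Function Filter Topology Metric
open scoped RealInnerProductSpace InnerProductSpace ENNReal Laplacian ContDiff
open Literature.Analysis Literature.Analysis.FluidPDE Literature.Analysis.UnboundedOperators
open Summit.NavierStokesRegularity.NavierStokesRegularity.Theorems.HalfSpaceWindowDoorCirculationCarryingRigidityDefs
open Summit.NavierStokesRegularity.NavierStokesRegularity.Theorems.HalfSpaceWindowDoorCirculationCarryingRigidityWindowedFlux
  (gaussWin_pos continuous_gaussWin integrable_gaussWin continuous_planePt integrable_fderiv_gaussWin)
open Summit.NavierStokesRegularity.NavierStokesRegularity.Theorems.HalfSpaceWindowDoorCirculationCarryingRigidityPlaneFlux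
  (norm_le_norm_planePt abs_fderiv_gaussWin_zero_apply_le)
open Summit.NavierStokesRegularity.NavierStokesRegularity.Theorems.HalfSpaceWindowDoorCirculationCarryingRigidityPlaneFluxHeightWindow
  (abs_inner_e3_le integral_gaussWin_div_le)
open Summit.NavierStokesRegularity.NavierStokesRegularity.Theorems.LocalSineTubeDoorProfileAlignedWindowRigidityAncient
  (bdd_of_hasTypeITimeDecay analyticOnNhd_slice)
open Summit.NavierStokesRegularity.NavierStokesRegularity.Theorems.PoloidalWindowDoorPoloidalWindowRigidityClassSpaceTimeRates
  (exists_fderiv_rate_of_class')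
open Summit.NavierStokesRegularity.NavierStokesRegularity.Theorems.ChiralWindowDoorClassDerivDecay (derivDecay_of_class)
open Summit.NavierStokesRegularity.NavierStokesRegularity.Theorems.RellichScarScarRigidity (norm_fderiv_coord_le_opNorm)

/-! ### A field with cubic decay against the window gradient -/

/-- The window gradient component `y ↦ ∂ⱼ g_{L,0}(y)` is continuous. -/
theorem continuous_fderiv_gaussWin_apply (L : ℝ) (w : EuclideanSpace ℝ (Fin 2)) :
    Continuous fun y : EuclideanSpace ℝ (Fin 2) => fderiv ℝ (gaussWin L 0) y w := by
  have h : (fun y : EuclideanSpace ℝ (Fin 2) => fderiv ℝ (gaussWin L 0) y w) =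
      fun y => fderiv ℝ (heatKernel (L ^ 2)) (y - 0) w := by
    funext y
    rw [Summit.NavierStokesRegularity.NavierStokesRegularity.Theorems.HalfSpaceWindowDoorCirculationCarryingRigidityWindowedFlux.fderiv_gaussWin_eq]
  rw [h]
  exact ((continuous_fderiv_heatKernel (L ^ 2)).comp (continuous_id.sub continuous_const)).clm_apply continuous_const

/-- **Cubic decay against the window gradient.**  For a continuous scalar `Q` on `ℝ³` with `|Q(x)|(‖x‖+ρ)³ ≤ A₃` (`ρ > 0`),
every `L, R > 0`, height `c` and `j = 0, 1`: `y ↦ Q(y,c) ∂ⱼg_{L,0}(y)` is integrable and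
`|∫ Q(y,c) ∂ⱼg_{L,0}(y) dy| ≤ (A₃/(2ρL²))·(1/R + eR²/(4ρL²))`. -/
theorem abs_integral_mul_fderiv_gaussWin_le_of_decay {Q : EuclideanSpace ℝ (Fin 3) → ℝ} (hQ : Continuous Q)
    {A₃ ρ : ℝ} (hρ : 0 < ρ) (hA : ∀ x, |Q x| * (‖x‖ + ρ) ^ 3 ≤ A₃) {L : ℝ} (hL : 0 < L) {R : ℝ} (hR : 0 < R)
    (c : ℝ) (j : Fin 2) :
    Integrable (fun y => Q (planePt c y) * fderiv ℝ (gaussWin L 0) y (EuclideanSpace.single j 1)) ∧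
      |∫ y, Q (planePt c y) * fderiv ℝ (gaussWin L 0) y (EuclideanSpace.single j 1)| ≤
        A₃ / (2 * ρ * L ^ 2) * (1 / R + Real.exp 1 * R ^ 2 / (4 * ρ * L ^ 2)) := by
  have hA0 : 0 ≤ A₃ := le_trans (by positivity) (hA 0)
  obtain ⟨hJint, hJle⟩ := integral_gaussWin_div_le hL hR hρ
  -- pointwise bound `|Q(y,c) ∂ⱼg(y)| ≤ (A₃/(2ρL²)) g(y)/(‖y‖+ρ)`
  have hpt : ∀ y : EuclideanSpace ℝ (Fin 2), ‖Q (planePt c y) * fderiv ℝ (gaussWin L 0) y (EuclideanSpace.single j 1)‖ ≤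
      A₃ / (2 * ρ * L ^ 2) * (gaussWin L 0 y / (‖y‖ + ρ)) := by
    intro y
    rw [norm_mul, Real.norm_eq_abs, Real.norm_eq_abs]
    have h2 := abs_fderiv_gaussWin_zero_apply_le hL y (EuclideanSpace.single j 1)
    rw [PiLp.norm_single, norm_one, mul_one] at h2
    have hg0 : 0 ≤ gaussWin L 0 y := (gaussWin_pos hL 0 y).le
    have hyρ : 0 < ‖y‖ + ρ := by positivity
    have hxρ : ‖y‖ + ρ ≤ ‖planePt c y‖ + ρ := by linarith [norm_le_norm_planePt c y]
    have h3 : |Q (planePt c y)| * ‖y‖ ≤ A₃ / (ρ * (‖y‖ + ρ)) := by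
      rw [le_div_iff₀ (by positivity)]
      have hq : 0 ≤ |Q (planePt c y)| := abs_nonneg _
      have hy1 : ‖y‖ ≤ ‖y‖ + ρ := le_add_of_nonneg_right hρ.le
      have hρ1 : ρ ≤ ‖y‖ + ρ := le_add_of_nonneg_left (norm_nonneg _)
      calc |Q (planePt c y)| * ‖y‖ * (ρ * (‖y‖ + ρ)) ≤ |Q (planePt c y)| * (‖y‖ + ρ) * ((‖y‖ + ρ) * (‖y‖ + ρ)) := by
            gcongr
        _ = |Q (planePt c y)| * (‖y‖ + ρ) ^ 3 := by ring
        _ ≤ |Q (planePt c y)| * (‖planePt c y‖ + ρ) ^ 3 := by gcongr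
        _ ≤ A₃ := hA _
    calc |Q (planePt c y)| * |fderiv ℝ (gaussWin L 0) y (EuclideanSpace.single j 1)|
        ≤ |Q (planePt c y)| * (gaussWin L 0 y * ‖y‖ / (2 * L ^ 2)) := mul_le_mul_of_nonneg_left h2 (abs_nonneg _)
      _ = (|Q (planePt c y)| * ‖y‖) * gaussWin L 0 y / (2 * L ^ 2) := by ring
      _ ≤ (A₃ / (ρ * (‖y‖ + ρ))) * gaussWin L 0 y / (2 * L ^ 2) := by gcongr
      _ = A₃ / (2 * ρ * L ^ 2) * (gaussWin L 0 y / (‖y‖ + ρ)) := by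
          field_simp
  have hcont : Continuous fun y : EuclideanSpace ℝ (Fin 2) => Q (planePt c y) * fderiv ℝ (gaussWin L 0) y (EuclideanSpace.single j 1) :=
    (hQ.comp (continuous_planePt c)).mul (continuous_fderiv_gaussWin_apply L _)
  have hbd := hJint.const_mul (A₃ / (2 * ρ * L ^ 2))
  have hint : Integrable (fun y => Q (planePt c y) * fderiv ℝ (gaussWin L 0) y (EuclideanSpace.single j 1)) :=
    Integrable.mono' hbd hcont.aestronglyMeasurable (ae_of_all _ hpt)
  refine ⟨hint, ?_⟩
  have h := norm_integral_le_of_norm_le hbd (ae_of_all _ hpt)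
  rw [Real.norm_eq_abs, integral_const_mul] at h
  exact h.trans (mul_le_mul_of_nonneg_left hJle (by positivity))

end Summit.NavierStokesRegularity.NavierStokesRegularity.Theorems.HalfSpaceWindowDoorCirculationCarryingRigidityPlaneFluxDecayPairing

end
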